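import Mathlib.Analysis.Convex.Slope
import Mathlib.Analysis.Convex.Deriv
import Mathlib.Data.Real.Basic
import Mathlib.Topology.Order.OrderClosed
import Mathlib.Topology.ContinuousOn
import Mathlib.Topology.Instances.Real.Lemmas
import Mathlib.Tactic.Linarith
import Mathlib.Tactic.FieldSimp
import HarnessLib

/-!
# FunctionalMining — towards `BurkConcave` (2): gluing concave pieces at a kink

search for candidate a priori estimates; no regularity claim.  Cell `pub-nsfunc`, prove seat gen 7.  Generic one-variable
real analysis for the assembly of `Laminate.BurkConcave` from the region lemmas of `…BurkholderConcaveRegions`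
(Burkholder 1991, LNM 1464, §8, (8.15)–(8.16): "`G'' ≤ 0` off a finite set and `G'(t₀−) ≥ G'(t₀+)` at its points, with
continuity, give concavity"):
* `concaveOn_Icc_glue` — if `f` is concave on `[a, b]` and on `[b, c]` and the secant slopes DROP across `b`
  (`slope(b, z) ≤ slope(x, b)` for `a ≤ x < b < z ≤ c`), then `f` is concave on `[a, c]`;
* `slope_left_anti_of_concaveOn` / `slope_right_anti_of_concaveOn` — monotonicity of secant slopes into / out of a point;
* `concaveOn_Icc_union_of_overlap` — concave pieces on OVERLAPPING closed intervals glue (the drop condition is automatic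
  at an interior point of the overlap).
* `concaveOn_Icc_of_Ioo` — concavity passes from `(a, b)` to `[a, b]` under continuity on `[a, b]` (appended);
* `concaveOn_Icc_glue_of_deriv` — the kink gluing stated with one-sided derivatives `R ≤ L` at `b` (appended).
Pure Mathlib-level lemmas (slope criterion `concaveOn_of_slope_anti_adjacent`); nothing about Navier–Stokes or laminates.
-/

namespace Summit.NavierStokesRegularity.FunctionalMining

namespace Burk

open Set Filter Topology

/-- Secant-slope bookkeeping: for `p < q`, `slope ≤ M ↔ f q − f p ≤ M (q − p)`. [ours; bookkeeping] -/
theorem slope_le_iff {f : ℝ → ℝ} {p q M : ℝ} (h : p < q) :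
    (f q - f p) / (q - p) ≤ M ↔ f q - f p ≤ M * (q - p) := by
  rw [div_le_iff₀ (sub_pos.2 h)]

/-- Secant-slope bookkeeping: for `p < q`, `M ≤ slope ↔ M (q − p) ≤ f q − f p`. [ours; bookkeeping] -/
theorem le_slope_iff {f : ℝ → ℝ} {p q M : ℝ} (h : p < q) :
    M ≤ (f q - f p) / (q - p) ↔ M * (q - p) ≤ f q - f p := by
  rw [le_div_iff₀ (sub_pos.2 h)]

/-- Secant-slope bookkeeping: for `p < q`, `f q − f p = slope · (q − p)`. [ours; bookkeeping] -/
theorem slope_mul_eq {f : ℝ → ℝ} {p q : ℝ} (h : p < q) :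
    (f q - f p) / (q - p) * (q - p) = f q - f p :=
  div_mul_cancel₀ _ (sub_pos.2 h).ne'

/-- For a concave function, secant slopes INTO a point decrease as the left endpoint increases:
`x < x' < b` ⇒ `slope(x', b) ≤ slope(x, b)`. [ours; elementary] -/
theorem slope_left_anti_of_concaveOn {f : ℝ → ℝ} {s : Set ℝ} (hf : ConcaveOn ℝ s f) {x x' b : ℝ}
    (hx : x ∈ s) (hb : b ∈ s) (hxx' : x < x') (hx'b : x' < b) :
    (f b - f x') / (b - x') ≤ (f b - f x) / (b - x) := by
  have h1 := slope_mul_eq (f := f) hx'b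
  have h2 : (f b - f x') / (b - x') * (x' - x) ≤ f x' - f x :=
    (le_slope_iff hxx').1 (hf.slope_anti_adjacent hx hb hxx' hx'b)
  rw [le_slope_iff (hxx'.trans hx'b)]
  nlinarith [h1, h2]

/-- For a concave function, secant slopes OUT OF a point decrease as the right endpoint increases:
`b < z' < z` ⇒ `slope(b, z) ≤ slope(b, z')`. [ours; elementary] -/
theorem slope_right_anti_of_concaveOn {f : ℝ → ℝ} {s : Set ℝ} (hf : ConcaveOn ℝ s f) {b z' z : ℝ}
    (hb : b ∈ s) (hz : z ∈ s) (hbz' : b < z') (hz'z : z' < z) :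
    (f z - f b) / (z - b) ≤ (f z' - f b) / (z' - b) := by
  have h1 := slope_mul_eq (f := f) hbz'
  have h2 : f z - f z' ≤ (f z' - f b) / (z' - b) * (z - z') :=
    (slope_le_iff hz'z).1 (hf.slope_anti_adjacent hb hz hbz' hz'z)
  rw [slope_le_iff (hbz'.trans hz'z)]
  nlinarith [h1, h2]

/-- **Gluing at a kink.**  If `f` is concave on `[a, b]` and on `[b, c]`, and the secant slopes drop across `b`
(`slope(b, z) ≤ slope(x, b)` whenever `a ≤ x < b < z ≤ c`), then `f` is concave on `[a, c]`.  (The drop hypothesis is what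
one-sided derivatives `f'(b−) ≥ f'(b+)` give.) [ours; elementary] -/
theorem concaveOn_Icc_glue {f : ℝ → ℝ} {a b c : ℝ} (h1 : ConcaveOn ℝ (Icc a b) f) (h2 : ConcaveOn ℝ (Icc b c) f)
    (hdrop : ∀ x z, a ≤ x → x < b → b < z → z ≤ c → (f z - f b) / (z - b) ≤ (f b - f x) / (b - x)) :
    ConcaveOn ℝ (Icc a c) f := by
  refine concaveOn_of_slope_anti_adjacent (convex_Icc a c) ?_
  intro x y z hx hz hxy hyz
  have hxa : a ≤ x := hx.1
  have hzc : z ≤ c := hz.2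
  rcases le_or_gt z b with hzb | hzb
  · -- all three points in `[a, b]`
    exact h1.slope_anti_adjacent ⟨hxa, by linarith⟩ ⟨by linarith, hzb⟩ hxy hyz
  rcases le_or_gt b x with hbx | hbx
  · -- all three points in `[b, c]`
    exact h2.slope_anti_adjacent ⟨hbx, by linarith⟩ ⟨by linarith, hzc⟩ hxy hyz
  -- `x < b < z`
  rcases lt_trichotomy y b with hyb | hyb | hyb
  · -- `y < b`: slope(y,z) is an average of slope(y,b) ≤ slope(x,y) and slope(b,z) ≤ slope(y,b)
    have s1 : (f b - f y) / (b - y) ≤ (f y - f x) / (y - x) :=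
      h1.slope_anti_adjacent ⟨hxa, hbx.le⟩ ⟨by linarith, le_rfl⟩ hxy hyb
    have s2 : (f z - f b) / (z - b) ≤ (f b - f y) / (b - y) := hdrop y z (by linarith) hyb hzb hzc
    have e1 := slope_mul_eq (f := f) hyb
    have e2 := slope_mul_eq (f := f) hzb
    rw [slope_le_iff hyz]
    nlinarith [s1, s2, e1, e2, sub_pos.2 hyb, sub_pos.2 hzb]
  · -- `y = b`
    subst hyb
    exact hdrop x z hxa hxy hyz hzc
  · -- `b < y`: slope(x,y) is an average of slope(x,b) and slope(b,y) ≥ slope(y,z)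
    have s1 : (f z - f y) / (z - y) ≤ (f y - f b) / (y - b) :=
      h2.slope_anti_adjacent ⟨le_rfl, by linarith⟩ ⟨by linarith, hzc⟩ hyb hyz
    have s2 : (f y - f b) / (y - b) ≤ (f b - f x) / (b - x) := hdrop x y hxa hbx hyb (by linarith)
    have e1 := slope_mul_eq (f := f) hbx
    have e2 := slope_mul_eq (f := f) hyb
    rw [le_slope_iff hxy]
    nlinarith [s1, s2, e1, e2, sub_pos.2 hbx, sub_pos.2 hyb]

/-- **Gluing on an overlap.**  If `f` is concave on `[a, c']` and on `[b', d]` with `a ≤ b' < c' ≤ d` (the overlap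
`[b', c']` has non-empty interior), then `f` is concave on `[a, d]`. [ours; elementary] -/
theorem concaveOn_Icc_union_of_overlap {f : ℝ → ℝ} {a b' c' d : ℝ} (hab : a ≤ b') (hbc : b' < c') (hcd : c' ≤ d)
    (h1 : ConcaveOn ℝ (Icc a c') f) (h2 : ConcaveOn ℝ (Icc b' d) f) : ConcaveOn ℝ (Icc a d) f := by
  -- glue at the midpoint `m` of the overlap
  set m := (b' + c') / 2 with hm
  have hbm : b' < m := by rw [hm]; linarith
  have hmc : m < c' := by rw [hm]; linarith
  have h1' : ConcaveOn ℝ (Icc a m) f := h1.subset (Icc_subset_Icc le_rfl hmc.le) (convex_Icc _ _)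
  have h2' : ConcaveOn ℝ (Icc m d) f := h2.subset (Icc_subset_Icc hbm.le le_rfl) (convex_Icc _ _)
  refine concaveOn_Icc_glue h1' h2' fun x z hxa hxm hmz hzd => ?_
  -- pick intermediate points in the overlap on both sides of `m`
  set x' := max x ((b' + m) / 2) with hx'
  set z' := min z ((m + c') / 2) with hz'
  have hx'1 : x ≤ x' := le_max_left _ _
  have hx'2 : b' < x' := lt_of_lt_of_le (by linarith) (le_max_right _ _)
  have hx'3 : x' < m := max_lt hxm (by linarith)
  have hz'1 : z' ≤ z := min_le_left _ _
  have hz'2 : z' < c' := lt_of_le_of_lt (min_le_right _ _) (by linarith)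
  have hz'3 : m < z' := lt_min hmz (by linarith)
  -- slope(m,z) ≤ slope(m,z') ≤ slope(x',m) ≤ slope(x,m)
  have t1 : (f z - f m) / (z - m) ≤ (f z' - f m) / (z' - m) := by
    rcases eq_or_lt_of_le hz'1 with h | h
    · rw [h]
    · exact slope_right_anti_of_concaveOn h2 ⟨hbm.le, by linarith⟩ ⟨by linarith, hzd⟩ hz'3 h
  have t2 : (f z' - f m) / (z' - m) ≤ (f m - f x') / (m - x') :=
    h2.slope_anti_adjacent ⟨hx'2.le, by linarith⟩ ⟨by linarith, by linarith⟩ hx'3 hz'3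
  have t3 : (f m - f x') / (m - x') ≤ (f m - f x) / (m - x) := by
    rcases eq_or_lt_of_le hx'1 with h | h
    · rw [h]
    · exact slope_left_anti_of_concaveOn h1 ⟨hxa, by linarith⟩ ⟨by linarith, hmc.le⟩ h hx'3
  exact t1.trans (t2.trans t3)

/-- **Concavity passes from an open interval to its closure under continuity**: if `f` is concave on `(a, b)` and
continuous on `[a, b]`, then `f` is concave on `[a, b]` (the concavity inequality is a closed condition along the
homothety `s ↦ m + s(· − m)` about the midpoint, `s → 1⁻`). [ours; elementary] -/
theorem concaveOn_Icc_of_Ioo {f : ℝ → ℝ} {a b : ℝ} (hab : a < b) (hf : ConcaveOn ℝ (Ioo a b) f)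
    (hc : ContinuousOn f (Icc a b)) : ConcaveOn ℝ (Icc a b) f := by
  refine ⟨convex_Icc a b, fun x hx y hy μ ν hμ hν hμν => ?_⟩
  set m := (a + b) / 2 with hm
  have hma : a < m := by rw [hm]; linarith
  have hmb : m < b := by rw [hm]; linarith
  -- homothety paths
  have path_mem_Ioo : ∀ {w : ℝ}, w ∈ Icc a b → ∀ {s : ℝ}, 0 < s → s < 1 → m + s * (w - m) ∈ Ioo a b := by
    intro w hw s hs0 hs1
    constructor <;> nlinarith [hw.1, hw.2]
  have path_mem_Icc : ∀ {w : ℝ}, w ∈ Icc a b → ∀ {s : ℝ}, 0 ≤ s → s ≤ 1 → m + s * (w - m) ∈ Icc a b := by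
    intro w hw s hs0 hs1
    constructor <;> nlinarith [hw.1, hw.2]
  have path_tendsto : ∀ {w : ℝ}, w ∈ Icc a b →
      Tendsto (fun s : ℝ => m + s * (w - m)) (𝓝[<] (1 : ℝ)) (𝓝[Icc a b] w) := by
    intro w hw
    refine tendsto_nhdsWithin_iff.2 ⟨?_, ?_⟩
    · have hcont : Continuous (fun s : ℝ => m + s * (w - m)) := by fun_prop
      have := hcont.tendsto 1
      simp only [one_mul, add_sub_cancel] at this
      exact this.mono_left nhdsWithin_le_nhds
    · have h1 : ∀ᶠ s in 𝓝[<] (1 : ℝ), s < 1 := eventually_mem_nhdsWithin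
      have h0 : ∀ᶠ s in 𝓝[<] (1 : ℝ), 0 < s := (eventually_gt_nhds zero_lt_one).filter_mono nhdsWithin_le_nhds
      filter_upwards [h0, h1] with s hs0 hs1
      exact path_mem_Icc hw hs0.le hs1.le
  -- values along the paths
  have hw : μ * x + ν * y ∈ Icc a b := by
    have ea : μ * a + ν * a = a := by rw [← add_mul, hμν, one_mul]
    have eb : μ * b + ν * b = b := by rw [← add_mul, hμν, one_mul]
    constructor
    · nlinarith [mul_le_mul_of_nonneg_left hx.1 hμ, mul_le_mul_of_nonneg_left hy.1 hν]
    · nlinarith [mul_le_mul_of_nonneg_left hx.2 hμ, mul_le_mul_of_nonneg_left hy.2 hν]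
  have key : ∀ᶠ s in 𝓝[<] (1 : ℝ),
      μ * f (m + s * (x - m)) + ν * f (m + s * (y - m)) ≤ f (m + s * (μ * x + ν * y - m)) := by
    have h1 : ∀ᶠ s in 𝓝[<] (1 : ℝ), s < 1 := eventually_mem_nhdsWithin
    have h0 : ∀ᶠ s in 𝓝[<] (1 : ℝ), 0 < s := (eventually_gt_nhds zero_lt_one).filter_mono nhdsWithin_le_nhds
    filter_upwards [h0, h1] with s hs0 hs1
    have := hf.2 (path_mem_Ioo hx hs0 hs1) (path_mem_Ioo hy hs0 hs1) hμ hν hμν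
    simp only [smul_eq_mul] at this
    have e : μ * (m + s * (x - m)) + ν * (m + s * (y - m)) = m + s * (μ * x + ν * y - m) := by
      have : μ = 1 - ν := by linarith
      rw [this]; ring
    rw [e] at this
    exact this
  -- limits of both sides
  have limL : Tendsto (fun s : ℝ => μ * f (m + s * (x - m)) + ν * f (m + s * (y - m))) (𝓝[<] (1 : ℝ))
      (𝓝 (μ * f x + ν * f y)) :=
    (((hc x hx).tendsto.comp (path_tendsto hx)).const_mul μ).add
      (((hc y hy).tendsto.comp (path_tendsto hy)).const_mul ν)
  have limR : Tendsto (fun s : ℝ => f (m + s * (μ * x + ν * y - m))) (𝓝[<] (1 : ℝ)) (𝓝 (f (μ * x + ν * y))) :=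
    (hc _ hw).tendsto.comp (path_tendsto hw)
  have := le_of_tendsto_of_tendsto limL limR key
  simpa [smul_eq_mul] using this

/-- **Gluing at a kink from ONE-SIDED DERIVATIVES** (the form in which Burkholder's (8.16) `G'(t₀−) ≥ G'(t₀+)` is used):
if `f` is concave on `[a, b]` and on `[b, c]`, has left derivative `L` and right derivative `R` at `b` with `R ≤ L`, then `f`
is concave on `[a, c]`. [ours; elementary, via Mathlib's `ConcaveOn.slope_le_of_hasDerivWithinAt_Ioi` /
`le_slope_of_hasDerivWithinAt_Iio`] -/
theorem concaveOn_Icc_glue_of_deriv {f : ℝ → ℝ} {a b c L R : ℝ} (hab : a < b) (hbc : b < c)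
    (h1 : ConcaveOn ℝ (Icc a b) f) (h2 : ConcaveOn ℝ (Icc b c) f)
    (hL : HasDerivWithinAt f L (Iio b) b) (hR : HasDerivWithinAt f R (Ioi b) b) (hRL : R ≤ L) :
    ConcaveOn ℝ (Icc a c) f := by
  refine concaveOn_Icc_glue h1 h2 fun x z hxa hxb hbz hzc => ?_
  have s1 : slope f b z ≤ R := h2.slope_le_of_hasDerivWithinAt_Ioi ⟨le_rfl, hbc.le⟩ ⟨hbz.le, hzc⟩ hbz hR
  have s2 : L ≤ slope f x b := h1.le_slope_of_hasDerivWithinAt_Iio ⟨hxa, hxb.le⟩ ⟨hab.le, le_rfl⟩ hxb hL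
  rw [slope_def_field] at s1 s2
  linarith

end Burk

end Summit.NavierStokesRegularity.FunctionalMining
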